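import Summits.HubbardSuperconductivity.HubbardSuperconductivity.Theses.LiebTwin
import Summits.HubbardSuperconductivity.HubbardSuperconductivity.Theorems.LiebTwinTwinOnsiteCondensationTwinPairOrderIdentity
import Literature.MathematicalPhysics.QuantumLattice.HubbardHubbardModelEtaODLROProofs
import Summits.HubbardSuperconductivity.HubbardSuperconductivity.Theorems.IsoperimetricCascadeAttractiveSWaveOverlap

/-!
# Crux `DWavePolarisedDiscordance` (K3′, stmt-HubbardSuperconductivity-15314, route `LiebTwin`) —
# negative-side toolkit I: `η`-towers as doublon sums, their Lieb matrices, and the disjoint-support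
# lemma for bond pair fields

First of three files recording, for provers and planners, that the bottom-of-spectrum clause of K3′ is
load-bearing (`FalseWithoutMinimality`) and that the staggered `η`-tower is the extremal discordant state
(`StaggeredTowerOrders`). This file is pure bookkeeping in the Jordan–Wigner occupation basis:

* Yang's tower `(η_ε†)^m|0⟩ = m! Σ_{#S=m} ε_S |S↑ ∪ S↓⟩` re-exported for the pairing map `S ↦ pairSet S S`
  with a FREE `DecidableEq` instance (`etaPairingState_eq_sum`, `star_doublonSum_dotProduct`,
  `pairAnnihilation_mulVec_doublonSum_succ`), its amplitudes and norm;
* its Lieb matrix `W = n!·diag(σ(α,α) ε_α)` (`liebW_etaPairingState`), `WᴴW = (n!)²·1`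
  (`star_liebW_mul_liebW_etaPairingState`), and `liebVec n 1 = Σ_S σ(S,S) |S↑ ∪ S↓⟩` (`liebVec_one_eq_sum`);
* DISJOINT SUPPORTS: a pair field `Δ_g` with no on-site component (`g 0 = 0`) maps `|S↑ ∪ S↓⟩` into
  configurations whose occupied-site set is still `S` (`pairField_mulVec_single_pairSet_apply`), hence the bond
  pair order of a doublon sum depends only on the moduli of its weights
  (`expect_pairField_doublonSum_eq_of_norm_eq`).

INSTANCE DISCIPLINE. Statements containing `Pi.single` on `Finset (Orb Λ)`, `Finset.image` into `Λ`, or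
`1`/`diagonal` on `Config Λ n` take `[DecidableEq Λ]` as a free argument, so that at the torus they unify with
the computable `Lex`/`Pi` instances carried by the crux statement (through `CFC.abs`) and by concrete
elaboration (cf. the remark in `LiebTwinTwinOnsiteCondensationAttractiveTwin`); the tree's general tower lemmas
carry the `LinearOrder`-derived instance and are re-exported once in flexible form via `convert`.

Sources: C. N. Yang, PRL **63** (1989) 2144, eqs. (4)–(10); E. H. Lieb, PRL **62** (1989) 1201, proof of Thm 1;
D. J. Scalapino, Phys. Rep. **250** (1995) 329, §2, eq. (2.2); F. H. L. Essler et al., *The One-Dimensional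
Hubbard Model* (2005) §2.1. Elementary; no definition is introduced.
-/

noncomputable section

-- the mandated namespace repeats `HubbardSuperconductivity` (single-problem summit, D-0017)
set_option linter.dupNamespace false

namespace Summit.HubbardSuperconductivity.HubbardSuperconductivity.Theorems.DWavePolarisedDiscordance.Negative

open Matrix Finset Literature.MathematicalPhysics.QuantumLattice Literature.Probability.LatticeModels
open Summit.HubbardSuperconductivity.HubbardSuperconductivity.Theorems.IsoperimetricCascade (mem_pairSet_self)
open scoped ComplexOrder

/-! ### Doublon configurations `pairSet S S` and the `η`-towers in closed form -/

section Doublon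

/-
INSTANCE DISCIPLINE. Every statement below that contains an instance-dependent term (`Pi.single` on
`Finset (Orb Λ)`, `Finset.image` into `Λ`, `1`/`diagonal` on `Config Λ n`) takes `[DecidableEq Λ]` as a
FREE argument, so that at the torus it unifies with the computable `Lex`/`Pi` instances that the crux
statement (through `CFC.abs`) and any concrete elaboration carry (cf. the remark in
`LiebTwinTwinOnsiteCondensationAttractiveTwin`). The tree's general `η`-tower lemmas carry the
`LinearOrder`-derived instance instead; they are re-exported once in flexible form (`convert`).
-/

variable {Λ : Type*} [LinearOrder Λ] [Fintype Λ]

omit [Fintype Λ] in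
/-- `‖σ(α, β)‖ = 1`. [folklore] -/
theorem norm_pairSign (α β : Finset Λ) : ‖pairSign α β‖ = 1 := by
  unfold pairSign
  rw [norm_prod]
  exact Finset.prod_eq_one fun a _ => by simp [jwSign]

omit [LinearOrder Λ] [Fintype Λ] in
/-- `‖ε_S‖ = 1` for a sign function `ε : Λ → ℤˣ`. [folklore] -/
theorem norm_prod_sign (ε : Λ → ℤˣ) (S : Finset Λ) : ‖∏ x ∈ S, ((ε x : ℤ) : ℂ)‖ = 1 := by
  rw [norm_prod]
  refine Finset.prod_eq_one fun x _ => ?_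
  rcases Int.units_eq_one_or (ε x) with h | h <;> simp [h]

variable [DecidableEq Λ]

/-- `c_i |s⟩ = σ_i(s) |s ∖ i⟩` (`i ∈ s`), else `0` — the tree's `annihilation_mulVec_single`, re-exported
with a free `DecidableEq` instance. Essler et al. (2005) §2.1. [folklore] -/
theorem annihilation_mulVec_single' (i : Orb Λ) (s : Finset (Orb Λ)) :
    annihilation i *ᵥ Pi.single s (1 : ℂ) =
      if i ∈ s then jwSign i s • Pi.single (s.erase i) 1 else 0 := by
  convert annihilation_mulVec_single i s

/-- Yang's tower in the occupation basis: `(η_ε†)^m |0⟩ = m! Σ_{#S = m} ε_S |S↑ ∪ S↓⟩`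
(the tree's `etaRaise_pow_mulVec_vacuum` for the pairing map `S ↦ S↑ ∪ S↓`).
Yang, PRL 63 (1989) 2144, eq. (7). [folklore] -/
theorem etaPairingState_eq_sum (ε : Λ → ℤˣ) (m : ℕ) :
    etaPairingState ε m = (m.factorial : ℂ) • ∑ S ∈ powersetCard m (univ : Finset Λ),
      (∏ x ∈ S, ((ε x : ℤ) : ℂ)) • Pi.single (pairSet S S) (1 : ℂ) := by
  rw [etaPairingState]
  convert etaRaise_pow_mulVec_vacuum (P := fun S => pairSet S S) mem_pairSet_self ε m

/-- Orthogonality count for signed doublon sums (the tree's `star_sum_pairs_dotProduct`, pairing map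
`S ↦ S↑ ∪ S↓`): `⟨Σ_{S ⊆ G} ε_S |S↑∪S↓⟩, Σ_{S ⊆ G'} ε_S |S↑∪S↓⟩⟩ = #{S ⊆ G ∩ G' : #S = m}`.
Yang, PRL 63 (1989) 2144, the count leading to eq. (10). [folklore] -/
theorem star_doublonSum_dotProduct (ε : Λ → ℤˣ) (m : ℕ) (G G' : Finset Λ) :
    star (∑ S ∈ powersetCard m G, (∏ x ∈ S, ((ε x : ℤ) : ℂ)) • Pi.single (pairSet S S) (1 : ℂ)) ⬝ᵥ
        (∑ S ∈ powersetCard m G', (∏ x ∈ S, ((ε x : ℤ) : ℂ)) • Pi.single (pairSet S S) (1 : ℂ)) =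
      ((powersetCard m (G ∩ G')).card : ℂ) := by
  convert star_sum_pairs_dotProduct (P := fun S => pairSet S S) mem_pairSet_self ε m G G'

/-- Pair annihilation on signed doublon sums (the tree's `pairAnnihilation_mulVec_sum_pairs_succ`,
pairing map `S ↦ S↑ ∪ S↓`): `c_{z↓} c_{z↑} Σ_{#S = m+1} ε_S |S↑∪S↓⟩ = ε_z Σ_{#T = m, z ∉ T} ε_T |T↑∪T↓⟩`.
Yang, PRL 63 (1989) 2144, the count leading to eq. (10). [folklore] -/
theorem pairAnnihilation_mulVec_doublonSum_succ (ε : Λ → ℤˣ) (m : ℕ) (z : Λ) :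
    (annihilation (orb z 1) * annihilation (orb z 0)) *ᵥ
        (∑ S ∈ powersetCard (m + 1) (univ : Finset Λ),
          (∏ x ∈ S, ((ε x : ℤ) : ℂ)) • Pi.single (pairSet S S) (1 : ℂ)) =
      ((ε z : ℤ) : ℂ) • ∑ T ∈ powersetCard m (univ.erase z),
        (∏ x ∈ T, ((ε x : ℤ) : ℂ)) • Pi.single (pairSet T T) (1 : ℂ) := by
  convert pairAnnihilation_mulVec_sum_pairs_succ (P := fun S => pairSet S S) mem_pairSet_self ε m z

/-- The amplitude of the tower on `α↑ ∪ β↓` (`#α = m`): `m! ε_α` if `α = β`, else `0`.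
Yang, PRL 63 (1989) 2144, eq. (7). [folklore] -/
theorem etaPairingState_apply_pairSet (ε : Λ → ℤˣ) {m : ℕ} (α β : Finset Λ) (hα : α.card = m) :
    etaPairingState ε m (pairSet α β) =
      if α = β then (m.factorial : ℂ) * ∏ x ∈ α, ((ε x : ℤ) : ℂ) else 0 := by
  rw [etaPairingState_eq_sum, Pi.smul_apply, Finset.sum_apply, smul_eq_mul]
  simp only [Pi.smul_apply, smul_eq_mul, Pi.single_apply]
  have key : ∀ S : Finset Λ, (pairSet α β = pairSet S S) ↔ (α = S ∧ β = S) := fun S =>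
    ⟨fun h => pairSet_injective h, fun h => by rw [h.1, h.2]⟩
  simp_rw [key]
  by_cases hab : α = β
  · subst hab
    rw [if_pos rfl, Finset.sum_eq_single α]
    · simp
    · intro S _ hS
      rw [if_neg, mul_zero]
      rintro ⟨h, -⟩
      exact hS h.symm
    · intro h
      exact absurd (mem_powersetCard.2 ⟨subset_univ _, hα⟩) h
  · rw [if_neg hab, Finset.sum_eq_zero]
    · rw [mul_zero]
    · intro S _
      rw [if_neg, mul_zero]
      rintro ⟨rfl, rfl⟩
      exact hab rfl

omit [DecidableEq Λ] in
/-- `⟨(η_ε†)^m|0⟩, (η_ε†)^m|0⟩⟩ = (m!)² C(|Λ|, m)`. Yang, PRL 63 (1989) 2144, below eq. (9). [folklore] -/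
theorem star_etaPairingState_dotProduct_self (ε : Λ → ℤˣ) (m : ℕ) :
    star (etaPairingState ε m) ⬝ᵥ etaPairingState ε m =
      (m.factorial : ℂ) ^ 2 * (((Fintype.card Λ).choose m : ℕ) : ℂ) := by
  rw [etaPairingState_eq_sum, star_smul_dotProduct_smul, star_doublonSum_dotProduct, univ_inter,
    card_powersetCard, card_univ, star_natCast]
  ring

/-- **Lieb matrix of the tower.** `W((η_ε†)^n|0⟩)_{αβ} = δ_{αβ} σ(α,α) n! ε_α`: diagonal with
entries of modulus `n!`. Lieb, PRL 62 (1989) 1201, proof of Thm 1; Yang, PRL 63 (1989) 2144, eq. (7). [folklore] -/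
theorem liebW_etaPairingState_apply (ε : Λ → ℤˣ) (n : ℕ) (α β : Config Λ n) :
    liebW n (etaPairingState ε n) α β =
      if α = β then pairSign α.1 α.1 * ((n.factorial : ℂ) * ∏ x ∈ α.1, ((ε x : ℤ) : ℂ)) else 0 := by
  rw [liebW_apply, etaPairingState_apply_pairSet ε α.1 β.1 α.2]
  by_cases h : α = β
  · subst h
    rw [if_pos rfl, if_pos rfl]
  · have h' : α.1 ≠ β.1 := fun h1 => h (Subtype.ext h1)
    rw [if_neg h', if_neg h, mul_zero]

/-- The Lieb matrix of the tower as a diagonal matrix. [folklore] -/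
theorem liebW_etaPairingState (ε : Λ → ℤˣ) (n : ℕ) :
    liebW n (etaPairingState ε n) =
      diagonal fun α : Config Λ n =>
        pairSign α.1 α.1 * ((n.factorial : ℂ) * ∏ x ∈ α.1, ((ε x : ℤ) : ℂ)) := by
  ext α β
  rw [liebW_etaPairingState_apply, diagonal_apply]

/-- `W((η_ε†)^n|0⟩)ᴴ W((η_ε†)^n|0⟩) = (n!)² · 1` (all signs square to one). [folklore] -/
theorem star_liebW_mul_liebW_etaPairingState (ε : Λ → ℤˣ) (n : ℕ) :
    star (liebW n (etaPairingState ε n)) * liebW n (etaPairingState ε n) =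
      ((n.factorial : ℂ) ^ 2) • (1 : Matrix (Config Λ n) (Config Λ n) ℂ) := by
  rw [liebW_etaPairingState, star_eq_conjTranspose, diagonal_conjTranspose, diagonal_mul_diagonal,
    ← diagonal_one, ← diagonal_smul]
  congr 1
  funext α
  simp only [Pi.star_apply, Pi.smul_apply, smul_eq_mul, mul_one, star_mul,
    LiebThm1.star_pairSign, star_prod_sign, star_natCast]
  have h1 := LiebThm1.pairSign_mul_self α.1 α.1
  have h2 := prod_sign_mul_self ε α.1
  linear_combination ((n.factorial : ℂ) ^ 2 * (∏ x ∈ α.1, ((ε x : ℤ) : ℂ)) ^ 2) * h1 +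
    ((n.factorial : ℂ) ^ 2) * h2

/-- `liebVec n 1 = Σ_{#S = n} σ(S,S) |S↑ ∪ S↓⟩`: the identity Lieb matrix is the unstaggered doublon
sum with Lieb's signs. Lieb, PRL 62 (1989) 1201, proof of Thm 1. [folklore] -/
theorem liebVec_one_eq_sum (n : ℕ) :
    liebVec n (1 : Matrix (Config Λ n) (Config Λ n) ℂ) =
      ∑ S ∈ powersetCard n (univ : Finset Λ), pairSign S S • Pi.single (pairSet S S) (1 : ℂ) := by
  funext u
  rw [Finset.sum_apply]
  simp only [Pi.smul_apply, Pi.single_apply, smul_eq_mul, mul_ite, mul_one, mul_zero]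
  rw [liebVec]
  by_cases hu : (upPart u).card = n ∧ (downPart u).card = n
  · rw [dif_pos hu, one_apply]
    by_cases hud : upPart u = downPart u
    · have hmem : upPart u ∈ powersetCard n (univ : Finset Λ) :=
        mem_powersetCard.2 ⟨subset_univ _, hu.1⟩
      rw [Finset.sum_eq_single_of_mem (upPart u) hmem]
      · have hu' : u = pairSet (upPart u) (upPart u) := by
          conv_lhs => rw [← pairSet_upPart_downPart u, ← hud]
        rw [if_pos hu', if_pos (Subtype.ext hud), mul_one, ← hud]
      · intro S _ hS
        rw [if_neg]
        intro h
        exact hS (by rw [h, upPart_pairSet])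
    · rw [if_neg (fun h => hud (congrArg Subtype.val h)), mul_zero, Finset.sum_eq_zero]
      intro S _
      rw [if_neg]
      intro h
      exact hud (by rw [h, upPart_pairSet, downPart_pairSet])
  · rw [dif_neg hu, Finset.sum_eq_zero]
    intro S hS
    rw [if_neg]
    intro h
    rw [h, upPart_pairSet, downPart_pairSet] at hu
    exact hu ⟨(mem_powersetCard.1 hS).2, (mem_powersetCard.1 hS).2⟩

end Doublon

/-! ### Pair fields without on-site component act on doublon sums with disjoint supports -/

section Support

-- `[DecidableEq Λ]` is a free argument on purpose (cf. `LiebTwinTwinOnsiteCondensationAttractiveTwin`):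
-- at the torus instance search finds the computable `Lex`/`Pi` instance, not the one inside `LinearOrder`.
variable {Λ : Type*} [LinearOrder Λ] [Fintype Λ] [DecidableEq Λ]

/-- Removing one orbital at each of two DISTINCT sites from a doublon configuration `S↑ ∪ S↓` leaves
every site of `S` occupied (the occupied-site set of the result is still `S`). [folklore] -/
theorem image_erase_erase_pairSet (S : Finset Λ) {i j : Orb Λ} (hij : (ofLex i).1 ≠ (ofLex j).1) :
    (((pairSet S S).erase j).erase i).image (fun o => (ofLex o).1) = S := by
  ext z
  simp only [mem_image, mem_erase, mem_pairSet_self]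
  constructor
  · rintro ⟨o, ⟨-, -, ho⟩, rfl⟩
    exact ho
  · intro hz
    by_cases h0 : orb z 0 = i
    · refine ⟨orb z 1, ⟨?_, ?_, ?_⟩, ?_⟩
      · rw [← h0]
        simp
      · intro h1
        apply hij
        rw [← h0, ← h1]
        simp [orb]
      · simpa [orb] using hz
      · simp [orb]
    · by_cases h0' : orb z 0 = j
      · refine ⟨orb z 1, ⟨?_, ?_, ?_⟩, ?_⟩
        · intro h1
          apply hij
          rw [← h0', ← h1]
          simp [orb]
        · rw [← h0']
          simp
        · simpa [orb] using hz
        · simp [orb]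
      · exact ⟨orb z 0, ⟨h0, h0', by simpa [orb] using hz⟩, by simp [orb]⟩

/-- Two annihilations at DISTINCT sites applied to `|S↑ ∪ S↓⟩` are supported on configurations whose
occupied-site set is `S`. Essler et al. (2005) §2.1 (Jordan–Wigner basis action). [folklore] -/
theorem annihilation_mul_annihilation_mulVec_single_pairSet_apply (S : Finset Λ) {i j : Orb Λ}
    (hij : (ofLex i).1 ≠ (ofLex j).1) {u : Finset (Orb Λ)}
    (hu : u.image (fun o => (ofLex o).1) ≠ S) :
    ((annihilation i * annihilation j) *ᵥ Pi.single (pairSet S S) (1 : ℂ)) u = 0 := by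
  rw [← mulVec_mulVec, annihilation_mulVec_single']
  by_cases hj : j ∈ pairSet S S
  · rw [if_pos hj, mulVec_smul, annihilation_mulVec_single']
    by_cases hi : i ∈ (pairSet S S).erase j
    · rw [if_pos hi, Pi.smul_apply, Pi.smul_apply, Pi.single_apply, if_neg, smul_zero, smul_zero]
      intro hu'
      exact hu (hu' ▸ image_erase_erase_pairSet S hij)
    · rw [if_neg hi, smul_zero, Pi.zero_apply]
  · rw [if_neg hj, mulVec_zero, Pi.zero_apply]

variable {L : ℕ} [NeZero L]

omit [NeZero L] in
/-- A unit step of `ℤ²` does not vanish on the torus `(ℤ/Lℤ)²` of side `L ≥ 2`. [folklore] -/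
theorem torusProj_ne_zero_of_mem_unitSteps [Fact (1 < L)] {e : Site 2} (he : e ∈ unitSteps) :
    Torus.proj L e ≠ 0 := by
  intro h
  simp only [unitSteps, mem_insert, mem_singleton] at he
  rcases he with rfl | rfl | rfl | rfl
  · have h0 := congrFun h 0
    simp [Torus.proj] at h0
  · have h0 := congrFun h 0
    simp [Torus.proj] at h0
  · have h0 := congrFun h 1
    simp [Torus.proj] at h0
  · have h0 := congrFun h 1
    simp [Torus.proj] at h0

/-- On a torus of side `L ≥ 2` the two ends of a nearest-neighbour bond are distinct sites. [folklore] -/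
theorem ofTorusSite_ne_ofTorusSite_add [Fact (1 < L)] (x : TorusSite 2 L) {e : Site 2}
    (he : e ∈ unitSteps) :
    FermionTorus.ofTorusSite x ≠ FermionTorus.ofTorusSite (x + Torus.proj L e) := by
  intro h
  have h' := congrArg FermionTorus.toTorusSite h
  rw [FermionTorus.toTorusSite_ofTorusSite, FermionTorus.toTorusSite_ofTorusSite] at h'
  exact torusProj_ne_zero_of_mem_unitSteps he (left_eq_add.1 h')

/-- **Disjoint supports.** A pair field `Δ_g` with no on-site component (`g 0 = 0`) applied to the
doublon configuration `|S↑ ∪ S↓⟩` is supported on configurations whose occupied-site set is `S`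
(each summand removes one `↑` and one `↓` orbital at the two DISTINCT ends of a bond, `L ≥ 2`).
Scalapino, Phys. Rep. 250 (1995) 329, §2, eq. (2.2). [folklore] -/
theorem pairField_mulVec_single_pairSet_apply [Fact (1 < L)] {g : Site 2 → ℝ} (hg : g 0 = 0)
    (S : Finset (FermionTorus 2 L)) {u : Finset (Orb (FermionTorus 2 L))}
    (hu : u.image (fun o => (ofLex o).1) ≠ S) :
    (pairField g L *ᵥ Pi.single (pairSet S S) (1 : ℂ)) u = 0 := by
  unfold pairField localPair
  rw [sum_mulVec, Finset.sum_apply]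
  refine Finset.sum_eq_zero fun x _ => ?_
  rw [sum_mulVec, Finset.sum_apply]
  refine Finset.sum_eq_zero fun e he => ?_
  rw [smul_mulVec, Pi.smul_apply, sub_mulVec, Pi.sub_apply]
  rcases Finset.mem_insert.1 he with rfl | he
  · rw [hg, zero_div, Complex.ofReal_zero, zero_smul]
  · have hne := ofTorusSite_ne_ofTorusSite_add x he
    rw [annihilation_mul_annihilation_mulVec_single_pairSet_apply S _ hu,
      annihilation_mul_annihilation_mulVec_single_pairSet_apply S _ hu, sub_zero, smul_zero] <;>
    simpa [orb] using hne

/-- A pair field with no on-site component on a doublon sum `Σ_{S ∈ 𝒮} w_S |S↑ ∪ S↓⟩`: its amplitude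
on `u` involves only the configuration `S = occ(u)` (disjoint supports). [folklore] -/
theorem pairField_mulVec_doublonSum_apply [Fact (1 < L)] {g : Site 2 → ℝ} (hg : g 0 = 0)
    (𝒮 : Finset (Finset (FermionTorus 2 L))) (w : Finset (FermionTorus 2 L) → ℂ)
    (u : Finset (Orb (FermionTorus 2 L))) :
    (pairField g L *ᵥ ∑ S ∈ 𝒮, w S • Pi.single (pairSet S S) (1 : ℂ)) u =
      if u.image (fun o => (ofLex o).1) ∈ 𝒮 then
        w (u.image fun o => (ofLex o).1) *
          (pairField g L *ᵥ Pi.single (pairSet (u.image fun o => (ofLex o).1)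
            (u.image fun o => (ofLex o).1)) (1 : ℂ)) u
      else 0 := by
  rw [mulVec_sum, Finset.sum_apply]
  have key : ∀ S ∈ 𝒮, (pairField g L *ᵥ (w S • Pi.single (pairSet S S) (1 : ℂ))) u =
      if u.image (fun o => (ofLex o).1) = S then
        w S * (pairField g L *ᵥ Pi.single (pairSet S S) (1 : ℂ)) u else 0 := by
    intro S _
    rw [mulVec_smul, Pi.smul_apply, smul_eq_mul]
    split_ifs with h
    · rfl
    · rw [pairField_mulVec_single_pairSet_apply hg S h, mul_zero]
  rw [Finset.sum_congr rfl key, Finset.sum_ite_eq]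

/-- **The bond pair order of a doublon sum depends only on the moduli of its weights.** For a pair field
`Δ_g` with `g 0 = 0` (e.g. `dWaveFormFactor`, `extendedSWave`) and weights with `‖w_S‖ = ‖w'_S‖`:
`⟨ψ_w, Δ_gᴴ Δ_g ψ_w⟩ = ⟨ψ_{w'}, Δ_gᴴ Δ_g ψ_{w'}⟩`, `ψ_w = Σ_{S ∈ 𝒮} w_S |S↑ ∪ S↓⟩` (disjoint supports:
`‖Δ_g ψ_w‖² = Σ_u ‖w_{occ u}‖² |(Δ_g |occ u⟩)(u)|²`). Scalapino, Phys. Rep. 250 (1995) 329, §2. [folklore] -/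
theorem expect_pairField_doublonSum_eq_of_norm_eq [Fact (1 < L)] {g : Site 2 → ℝ} (hg : g 0 = 0)
    (𝒮 : Finset (Finset (FermionTorus 2 L))) {w w' : Finset (FermionTorus 2 L) → ℂ}
    (h : ∀ S ∈ 𝒮, ‖w S‖ = ‖w' S‖) :
    expect ((pairField g L)ᴴ * pairField g L) (∑ S ∈ 𝒮, w S • Pi.single (pairSet S S) (1 : ℂ)) =
      expect ((pairField g L)ᴴ * pairField g L)
        (∑ S ∈ 𝒮, w' S • Pi.single (pairSet S S) (1 : ℂ)) := by
  rw [PosSemidefTrace.expect_conjTranspose_mul, PosSemidefTrace.expect_conjTranspose_mul,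
    dotProduct, dotProduct]
  refine Finset.sum_congr rfl fun u _ => ?_
  rw [Pi.star_apply, Pi.star_apply, pairField_mulVec_doublonSum_apply hg,
    pairField_mulVec_doublonSum_apply hg]
  split_ifs with hu
  · set a := u.image fun o => (ofLex o).1
    set X := (pairField g L *ᵥ Pi.single (pairSet a a) (1 : ℂ)) u
    have key : star (w a) * w a = star (w' a) * w' a := by
      rw [Complex.star_def, Complex.conj_mul', Complex.conj_mul', h a hu]
    calc star (w a * X) * (w a * X) = (star (w a) * w a) * (star X * X) := by rw [star_mul]; ring
      _ = (star (w' a) * w' a) * (star X * X) := by rw [key]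
      _ = star (w' a * X) * (w' a * X) := by rw [star_mul]; ring
  · rfl

end Support

end Summit.HubbardSuperconductivity.HubbardSuperconductivity.Theorems.DWavePolarisedDiscordance.Negative

end
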